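import Mathlib
import HarnessLib
import Summits.NavierStokesRegularity.NavierStokesRegularity.Theorems.HalfSpaceWindowDoorCirculationCarryingRigidityTimeOnlyExcess

/-!
# Route `HalfSpaceWindowDoor`, crux `CirculationCarryingRigidity` (stmt-NavierStokesRegularity-25311) — THE TIME-ONLY CLASS,
# FAR-PAST FORM: the excess hypothesis BEFORE SOME EPOCH already forces a poloidal profile

Line `eddy_torque` (LEAD ns-hsw-p1 g5).  The master census theorem of the time-only class (`…TimeOnlyExcess`) assumes the
eddy-torque excess bound `ℛ ≤ (1 + r v̄_r)Γ/r² + κΓ/(−s)` (`0 ≤ κ < 1/2`) on every axis circle at EVERY negative time.  The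
maximum-principle argument for `V(t,·)` only meets times `≤ t`, so the bound before an epoch `s₁ ≤ 0` gives `V ≡ 0`, hence
`Γ ≡ 0` and `ω₃ ≡ 0`, on the ray `s < s₁`; space–time analyticity of the class (`…HemisphereSupport.inner_curl_e3_eq_zero_of_open`)
then propagates `ω₃ ≡ 0` to the whole slab `s < 0`:

  **Theorem** (`inner_curl_e3_eq_zero_of_excess_lt_half_farPast`).  A door-class profile with the sign `ω₃ ≥ 0` whose eddy
  torque obeys `ℛ ≤ (1 + r v̄_r)Γ/r² + κΓ/(−s)` on every axis circle at every time BEFORE SOME EPOCH `s₁ ≤ 0`, for some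
  `0 ≤ κ < 1/2`, is poloidal on the whole slab.  (All time-only rows — outflow + spin-down, `C² < 2` + spin-down, the master row —
  thus hold in «eventually in the far past» form, the format of the parallel Gaussian-angular-momentum census.)

All statements concern HYPOTHETICAL blow-up profiles; nothing here is a regularity claim for Navier–Stokes.  The crux itself
stays open.
-/

set_option linter.dupNamespace false
set_option autoImplicit false

namespace Summit.NavierStokesRegularity.NavierStokesRegularity.Theorems.HalfSpaceWindowDoorCirculationCarryingRigidityTimeOnlyExcessRay

open Set Filter Topology Function
open scoped Laplacian RealInnerProductSpace ContDiff Classical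
open Literature.Analysis Literature.Analysis.FluidPDE
open Summit.NavierStokesRegularity.NavierStokesRegularity.Theorems.AxisTwistDoorAveragedConeLiouvilleDefs
  (cylPt eT e3 circ vortCirc radVortCirc meanR meanZ remainder SignE3)
open Summit.NavierStokesRegularity.NavierStokesRegularity.Theorems.AveragedConeLiouville.CircleStokes (deriv_circ_eq_vortCirc)
open Summit.NavierStokesRegularity.NavierStokesRegularity.Theorems.AveragedConeLiouville.FlatFlux
  (eq_zero_of_integral_eq_zero_of_nonneg exists_cylPt_eq)
open Summit.NavierStokesRegularity.NavierStokesRegularity.Theorems.AveragedConeLiouville.ShellBookkeeping (cylRadius_cylPt)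
open Summit.NavierStokesRegularity.NavierStokesRegularity.Theorems.AxisTwistDoorAveragedConeLiouvilleCylFrame (continuous_cylPt_θ)
open Summit.NavierStokesRegularity.NavierStokesRegularity.Theorems.HalfSpaceWindowDoorCirculationCarryingRigidityAxisCirculation
open Summit.NavierStokesRegularity.NavierStokesRegularity.Theorems.HalfSpaceWindowDoorCirculationCarryingRigidityHemisphereSupport
  (inner_curl_e3_eq_zero_of_open)
open Summit.NavierStokesRegularity.NavierStokesRegularity.Theorems.HalfSpaceWindowDoorCirculationCarryingRigidityTimeOnlyVEquation
  (hasDerivAt_V_time V_law)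
open Summit.NavierStokesRegularity.NavierStokesRegularity.Theorems.HalfSpaceWindowDoorCirculationCarryingRigidityTimeOnlyOutflow
  (V_le V_nonneg continuousOn_V)
open Summit.NavierStokesRegularity.NavierStokesRegularity.Theorems.HalfSpaceWindowDoorCirculationCarryingRigidityWholeSpaceMaxPrinciple
  (le_of_subsolution)
open Summit.NavierStokesRegularity.NavierStokesRegularity.Theorems.PoloidalWindowDoorPoloidalWindowRigidityClassSpaceTimeRates
  (exists_fderiv_rate_of_class')
open Summit.NavierStokesRegularity.NavierStokesRegularity.Theorems.PoloidalWindowDoorPoloidalWindowRigidityLargeScaleEnergyBootstrapLevels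
  (typeI_const_nonneg)

variable {C : ℝ} {v : ℝ → EuclideanSpace ℝ (Fin 3) → EuclideanSpace ℝ (Fin 3)}

/-! ### The pointwise form of the excess inequality -/

/-- **Pointwise excess ⇒ pointwise rate**: at an off-axis point, the excess bound on ITS circle gives
`∂ₛV + DV[⟨v⟩_θ] − ΔV ≤ κV/(−s)` there (sign-free). -/
theorem V_ineq_of_excess_at {κ : ℝ} (hrate : HasTypeITimeDecay C v)
    (hcont : ContinuousOn (uncurry v) (Iio (0 : ℝ) ×ˢ univ))
    (hmild : ∀ s t : ℝ, s < t → t < 0 → ∀ x,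
      v t x = UnboundedOperators.heatExtension (v s) (t - s) x - oseenDuhamel 1 s v v t x)
    (hdiv : ∀ t < 0, VectorCalculus.IsDivFree (v t))
    {σ : ℝ} (hσ : σ < 0) {x : EuclideanSpace ℝ (Fin 3)} (hx : cylRadius x ≠ 0)
    (hexc : remainder v (cylRadius x) (x 2) σ ≤
      (1 + cylRadius x * meanR v (cylRadius x) (x 2) σ) * circ v (cylRadius x) (x 2) σ / cylRadius x ^ 2
        + κ * circ v (cylRadius x) (x 2) σ / (-σ)) :
    deriv (fun σ' => (2 * Real.pi)⁻¹ * circ v (cylRadius x) (x 2) σ' / cylRadius x) σ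
        + fderiv ℝ (fun y : EuclideanSpace ℝ (Fin 3) => (2 * Real.pi)⁻¹ * circ v (cylRadius y) (y 2) σ / cylRadius y) x
            (angularMeanVec (v σ) x)
        - (Δ (fun y : EuclideanSpace ℝ (Fin 3) => (2 * Real.pi)⁻¹ * circ v (cylRadius y) (y 2) σ / cylRadius y)) x
      ≤ κ / (-σ) * ((2 * Real.pi)⁻¹ * circ v (cylRadius x) (x 2) σ / cylRadius x) := by
  have hr : 0 < cylRadius x := lt_of_le_of_ne (cylRadius_nonneg x) (Ne.symm hx)
  rw [V_law hrate hcont hmild hdiv hσ hx]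
  obtain ⟨Γ, hΓdef⟩ : ∃ Γ, Γ = circ v (cylRadius x) (x 2) σ := ⟨_, rfl⟩
  obtain ⟨R, hRdef⟩ : ∃ R, R = remainder v (cylRadius x) (x 2) σ := ⟨_, rfl⟩
  obtain ⟨mR, hmRdef⟩ : ∃ mR, mR = meanR v (cylRadius x) (x 2) σ := ⟨_, rfl⟩
  obtain ⟨r, hrdef⟩ : ∃ r, r = cylRadius x := ⟨_, rfl⟩
  rw [← hΓdef, ← hRdef, ← hmRdef, ← hrdef] at hexc ⊢
  rw [← hrdef] at hr
  have h1 : R - mR * Γ / r - Γ / r ^ 2 ≤ κ * Γ / (-σ) := by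
    have e : (1 + r * mR) * Γ / r ^ 2 = mR * Γ / r + Γ / r ^ 2 := by
      field_simp
      ring
    linarith [e ▸ hexc]
  have hfac : 0 ≤ (2 * Real.pi)⁻¹ * r⁻¹ := by positivity
  calc (2 * Real.pi)⁻¹ * r⁻¹ * (R - mR * Γ / r - Γ / r ^ 2)
      ≤ (2 * Real.pi)⁻¹ * r⁻¹ * (κ * Γ / (-σ)) := mul_le_mul_of_nonneg_left h1 hfac
    _ = κ / (-σ) * ((2 * Real.pi)⁻¹ * Γ / r) := by ring

/-! ### The weighted maximum principle before the epoch -/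

/-- **`V ≤ 0` BEFORE THE EPOCH under the far-past excess hypothesis, the sign and `κ < 1/2`** (the proof of
`…TimeOnlyExcess.V_nonpos_of_excess` verbatim: the maximum principle on `[s₀,t]`, `t < s₁`, only meets times before `s₁`). -/
theorem V_nonpos_of_excess_ray {κ s₁ : ℝ} (hs₁ : s₁ ≤ 0) (hrate : HasTypeITimeDecay C v)
    (hcont : ContinuousOn (uncurry v) (Iio (0 : ℝ) ×ˢ univ))
    (hmild : ∀ s t : ℝ, s < t → t < 0 → ∀ x,
      v t x = UnboundedOperators.heatExtension (v s) (t - s) x - oseenDuhamel 1 s v v t x)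
    (hdiv : ∀ t < 0, VectorCalculus.IsDivFree (v t)) (hsign : SignE3 v) (hκ0 : 0 ≤ κ) (hκ : κ < 1 / 2)
    (hexc : ∀ s < s₁, ∀ r : ℝ, 0 < r → ∀ z : ℝ,
      remainder v r z s ≤ (1 + r * meanR v r z s) * circ v r z s / r ^ 2 + κ * circ v r z s / (-s))
    {t : ℝ} (ht1 : t < s₁) (x : EuclideanSpace ℝ (Fin 3)) :
    (2 * Real.pi)⁻¹ * circ v (cylRadius x) (x 2) t / cylRadius x ≤ 0 := by
  have ht : t < 0 := lt_of_lt_of_le ht1 hs₁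
  have hsm : IsSmoothSpaceTimeOn (Iio (0 : ℝ)) v := isSmoothSpaceTimeOn_of_class hrate hcont hmild hdiv
  have hC := typeI_const_nonneg hrate
  obtain ⟨K, hK0, hK⟩ := exists_fderiv_rate_of_class' hrate hcont hmild
  obtain ⟨a, ha⟩ : ∃ a, a = κ := ⟨_, rfl⟩
  have ha0 : 0 ≤ a := by rw [ha]; exact hκ0
  -- the weighted maximum principle on `[s₀, t]`
  have hmp : ∀ s₀ < t, (-t) ^ a * ((2 * Real.pi)⁻¹ * circ v (cylRadius x) (x 2) t / cylRadius x) ≤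
      (-s₀) ^ a * (C / Real.sqrt (-s₀)) := by
    intro s₀ hs₀
    have hΛ : 0 ≤ C / Real.sqrt (-t) := by positivity
    refine le_of_subsolution (q := fun σ (y : EuclideanSpace ℝ (Fin 3)) =>
        (-σ) ^ a * ((2 * Real.pi)⁻¹ * circ v (cylRadius y) (y 2) σ / cylRadius y))
      (b := fun σ y => angularMeanVec (v σ) y) (B := (-s₀) ^ a * (C / Real.sqrt (-t))) hΛ ?_ ?_ ?_ ?_
      t (right_mem_Icc.2 hs₀.le) x
    · -- joint continuity
      have hw : Continuous fun p : ℝ × EuclideanSpace ℝ (Fin 3) => (-p.1) ^ a :=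
        (Real.continuous_rpow_const ha0).comp (continuous_neg.comp continuous_fst)
      exact hw.continuousOn.mul (continuousOn_V hsm hK0 hK ht)
    · -- the uniform bound on the slab
      intro σ hσ y
      have hσ0 : σ < 0 := lt_of_le_of_lt hσ.2 ht
      have h1 : (-σ) ^ a ≤ (-s₀) ^ a := Real.rpow_le_rpow (by linarith) (by linarith [hσ.1]) ha0
      have h2 : (2 * Real.pi)⁻¹ * circ v (cylRadius y) (y 2) σ / cylRadius y ≤ C / Real.sqrt (-t) :=
        (V_le hrate hσ0 y).trans
          (div_le_div_of_nonneg_left hC (Real.sqrt_pos.2 (by linarith)) (Real.sqrt_le_sqrt (by linarith [hσ.2])))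
      exact mul_le_mul h1 h2 (V_nonneg hsm hsign hσ0 y) (Real.rpow_nonneg (by linarith) _)
    · -- the initial bound
      intro y
      exact mul_le_mul_of_nonneg_left (V_le hrate (by linarith) y) (Real.rpow_nonneg (by linarith) _)
    · -- the subsolution property on `{U > m}`
      intro σ hσ y hmy
      have hσ0 : σ < 0 := lt_of_le_of_lt hσ.2 ht
      have hnσ : 0 < -σ := by linarith
      have hm0 : 0 ≤ (-s₀) ^ a * (C / Real.sqrt (-s₀)) :=
        mul_nonneg (Real.rpow_nonneg (by linarith) _) (by positivity)
      have hwpos : 0 < (-σ) ^ a := Real.rpow_pos_of_pos hnσ _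
      have hVpos : 0 < (2 * Real.pi)⁻¹ * circ v (cylRadius y) (y 2) σ / cylRadius y := by
        by_contra hle
        have : (-σ) ^ a * ((2 * Real.pi)⁻¹ * circ v (cylRadius y) (y 2) σ / cylRadius y) ≤ 0 :=
          mul_nonpos_of_nonneg_of_nonpos hwpos.le (not_lt.1 hle)
        exact absurd (hm0.trans_lt hmy) (not_lt.2 this)
      have hy : cylRadius y ≠ 0 := by
        intro h0
        rw [h0, div_zero] at hVpos
        exact lt_irrefl _ hVpos
      have hr : 0 < cylRadius y := lt_of_le_of_ne (cylRadius_nonneg y) (Ne.symm hy)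
      -- local smoothness of `V(σ,·)` near `y`
      have hF : ContDiff ℝ 2 fun y' : EuclideanSpace ℝ (Fin 3) => (2 * Real.pi)⁻¹ * circ v (cylRadius y') (y' 2) σ :=
        contDiff_circF ((hsm.contDiff_slice hσ0).of_le (by norm_cast))
      have hVU : ContDiffOn ℝ 2 (fun y' : EuclideanSpace ℝ (Fin 3) =>
          (2 * Real.pi)⁻¹ * circ v (cylRadius y') (y' 2) σ / cylRadius y') {y' | cylRadius y / 2 < cylRadius y'} := by
        refine hF.contDiffOn.div (fun y' hy' => ?_) fun y' hy' => ?_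
        · have : cylRadius y / 2 < cylRadius y' := hy'
          exact (contDiffAt_cylRadius (ne_of_gt (by linarith [cylRadius_nonneg y]))).contDiffWithinAt
        · have : cylRadius y / 2 < cylRadius y' := hy'
          exact ne_of_gt (by linarith [cylRadius_nonneg y])
      have hopen : IsOpen {y' : EuclideanSpace ℝ (Fin 3) | cylRadius y / 2 < cylRadius y'} :=
        isOpen_lt continuous_const continuous_cylRadius
      have hyU : y ∈ {y' : EuclideanSpace ℝ (Fin 3) | cylRadius y / 2 < cylRadius y'} := by
        show cylRadius y / 2 < cylRadius y; linarith
      have hVat : ContDiffAt ℝ 2 (fun y' : EuclideanSpace ℝ (Fin 3) =>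
          (2 * Real.pi)⁻¹ * circ v (cylRadius y') (y' 2) σ / cylRadius y') y := hVU.contDiffAt (hopen.mem_nhds hyU)
      have hVd : DifferentiableAt ℝ (fun y' : EuclideanSpace ℝ (Fin 3) =>
          (2 * Real.pi)⁻¹ * circ v (cylRadius y') (y' 2) σ / cylRadius y') y := hVat.differentiableAt (by norm_num)
      refine ⟨?_, ⟨_, hopen, hyU, contDiffOn_const.mul hVU⟩, ?_⟩
      · have h1 : ‖angularMeanVec (v σ) y‖ ≤ C / Real.sqrt (-σ) :=
          norm_angularMeanVec_le (b := fun _ => C / Real.sqrt (-σ)) (fun x' => hrate σ hσ0 x') y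
        exact h1.trans (div_le_div_of_nonneg_left hC (Real.sqrt_pos.2 (by linarith))
          (Real.sqrt_le_sqrt (by linarith [hσ.2])))
      · -- time derivative of `U(·,y)` and the inequality
        have hVt := hasDerivAt_V_time hsm hσ0 y
        have hw : HasDerivAt (fun τ : ℝ => (-τ) ^ a) (-1 * a * (-σ) ^ (a - 1)) σ :=
          (hasDerivAt_neg σ).rpow_const (Or.inl hnσ.ne')
        refine ⟨_, hw.mul hVt, ?_⟩
        -- `DU[b] = (−σ)^a DV[b]`, `ΔU = (−σ)^a ΔV`
        have hfd : fderiv ℝ (fun y' : EuclideanSpace ℝ (Fin 3) =>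
            (-σ) ^ a * ((2 * Real.pi)⁻¹ * circ v (cylRadius y') (y' 2) σ / cylRadius y')) y (angularMeanVec (v σ) y) =
            (-σ) ^ a * fderiv ℝ (fun y' : EuclideanSpace ℝ (Fin 3) =>
              (2 * Real.pi)⁻¹ * circ v (cylRadius y') (y' 2) σ / cylRadius y') y (angularMeanVec (v σ) y) := by
          rw [fderiv_const_mul hVd, _root_.smul_apply, smul_eq_mul]
        have hlap : (Δ (fun y' : EuclideanSpace ℝ (Fin 3) =>
            (-σ) ^ a * ((2 * Real.pi)⁻¹ * circ v (cylRadius y') (y' 2) σ / cylRadius y'))) y =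
            (-σ) ^ a * (Δ (fun y' : EuclideanSpace ℝ (Fin 3) =>
              (2 * Real.pi)⁻¹ * circ v (cylRadius y') (y' 2) σ / cylRadius y')) y := by
          have e : (fun y' : EuclideanSpace ℝ (Fin 3) =>
              (-σ) ^ a * ((2 * Real.pi)⁻¹ * circ v (cylRadius y') (y' 2) σ / cylRadius y')) =
              (-σ) ^ a • fun y' : EuclideanSpace ℝ (Fin 3) =>
                (2 * Real.pi)⁻¹ * circ v (cylRadius y') (y' 2) σ / cylRadius y' := by
            funext y'; simp [smul_eq_mul]
          rw [e, InnerProductSpace.laplacian_smul _ hVat, smul_eq_mul]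
        rw [hfd, hlap]
        have hσ1 : σ < s₁ := lt_of_le_of_lt hσ.2 ht1
        have hineq := V_ineq_of_excess_at hrate hcont hmild hdiv hσ0 hy (hexc σ hσ1 (cylRadius y) hr (y 2))
        rw [hVt.deriv, ← ha] at hineq
        -- `(−σ)^{a−1} = (−σ)^a/(−σ)`
        have hpow : (-σ) ^ (a - 1) = (-σ) ^ a / (-σ) := Real.rpow_sub_one hnσ.ne' a
        rw [hpow]
        have hkey : (-σ) ^ a * (a / (-σ) *
            ((2 * Real.pi)⁻¹ * circ v (cylRadius y) (y 2) σ / cylRadius y)) =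
            a * ((-σ) ^ a / (-σ)) * ((2 * Real.pi)⁻¹ * circ v (cylRadius y) (y 2) σ / cylRadius y) := by
          field_simp
        nlinarith [mul_le_mul_of_nonneg_left hineq hwpos.le, hkey]
  -- let `s₀ → −∞`: `(−s₀)^a · C/√(−s₀) = C (−s₀)^{a − 1/2} → 0` since `a < 1/2`
  have ha12 : 0 < 1 / 2 - a := by rw [ha]; linarith
  have hlim : Tendsto (fun s₀ : ℝ => (-s₀) ^ a * (C / Real.sqrt (-s₀))) atBot (𝓝 0) := by
    have h1 : Tendsto (fun u : ℝ => u ^ (-(1 / 2 - a))) atTop (𝓝 0) := tendsto_rpow_neg_atTop ha12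
    have h2 := (h1.comp tendsto_neg_atBot_atTop).const_mul C
    rw [mul_zero] at h2
    have hev : (fun s₀ : ℝ => C * (fun u : ℝ => u ^ (-(1 / 2 - a))) (-s₀)) =ᶠ[atBot]
        fun s₀ => (-s₀) ^ a * (C / Real.sqrt (-s₀)) := by
      filter_upwards [eventually_lt_atBot (0 : ℝ)] with s₀ hs₀
      have hn : 0 < -s₀ := by linarith
      show C * (-s₀) ^ (-(1 / 2 - a)) = (-s₀) ^ a * (C / Real.sqrt (-s₀))
      rw [Real.sqrt_eq_rpow, show -(1 / 2 - a) = a - 1 / 2 by ring, Real.rpow_sub hn]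
      field_simp
    exact h2.congr' hev
  have hle : (-t) ^ a * ((2 * Real.pi)⁻¹ * circ v (cylRadius x) (x 2) t / cylRadius x) ≤ 0 :=
    ge_of_tendsto hlim ((eventually_lt_atBot t).mono fun s₀ hs₀ => hmp s₀ hs₀)
  have hwpos : 0 < (-t) ^ a := Real.rpow_pos_of_pos (by linarith) _
  by_contra hpos
  have : 0 < (-t) ^ a * ((2 * Real.pi)⁻¹ * circ v (cylRadius x) (x 2) t / cylRadius x) :=
    mul_pos hwpos (not_le.1 hpos)
  linarith

/-! ### Poloidal before the epoch, hence everywhere -/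

/-- **`Γ ≡ 0` before an epoch ⇒ poloidal on the whole slab** (the proof of `…EddyTorqueOneSidedLiouville.poloidal_of_circF_eq_zero`
on the open space–time set `(−∞,s₁) × {y₁ > 0}`, then space–time analyticity `inner_curl_e3_eq_zero_of_open`). -/
theorem poloidal_of_circF_eq_zero_farPast (hrate : HasTypeITimeDecay C v)
    (hcont : ContinuousOn (uncurry v) (Iio (0 : ℝ) ×ˢ univ))
    (hmild : ∀ s t : ℝ, s < t → t < 0 → ∀ x,
      v t x = UnboundedOperators.heatExtension (v s) (t - s) x - oseenDuhamel 1 s v v t x)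
    (hdiv : ∀ t < 0, VectorCalculus.IsDivFree (v t)) (hsign : SignE3 v) {s₁ : ℝ} (hs₁ : s₁ ≤ 0)
    (hF0 : ∀ t < s₁, ∀ x : EuclideanSpace ℝ (Fin 3), (2 * Real.pi)⁻¹ * circ v (cylRadius x) (x 2) t = 0) :
    ∀ s < 0, ∀ y, inner ℝ (curl (v s) y) (EuclideanSpace.single (2 : Fin 3) (1 : ℝ)) = 0 := by
  have hsm : IsSmoothSpaceTimeOn (Iio (0 : ℝ)) v := isSmoothSpaceTimeOn_of_class hrate hcont hmild hdiv
  have hcirc : ∀ s < s₁, ∀ r : ℝ, 0 ≤ r → ∀ z : ℝ, circ v r z s = 0 := by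
    intro s hs r hr z
    have h := hF0 s hs (cylPt r 0 z)
    rw [cylRadius_cylPt hr] at h
    have hz : (cylPt r 0 z) 2 = z := by simp [cylPt]
    rw [hz] at h
    have hπ : (2 * Real.pi)⁻¹ ≠ 0 := by positivity
    exact (mul_eq_zero.1 h).resolve_left hπ
  have hvort0 : ∀ s < s₁, ∀ r : ℝ, 0 < r → ∀ z : ℝ, vortCirc v r z s = 0 := by
    intro s hs r hr z
    have hv1 : ContDiff ℝ 1 (v s) := (hsm.contDiff_slice (lt_of_lt_of_le hs hs₁)).of_le (by norm_cast)
    have hev : (fun r' => circ v r' z s) =ᶠ[𝓝 r] fun _ => (0 : ℝ) := by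
      filter_upwards [Ioi_mem_nhds hr] with r' hr'
      exact hcirc s hs r' (le_of_lt hr') z
    rw [← deriv_circ_eq_vortCirc v hv1 r z, hev.deriv_eq, deriv_const]
  set O : Set (ℝ × EuclideanSpace ℝ (Fin 3)) := Iio s₁ ×ˢ {y | 0 < y 1} with hO
  have hOopen : IsOpen O := isOpen_Iio.prod (isOpen_lt continuous_const (EuclideanSpace.proj (1 : Fin 3)).continuous)
  have hOne : O.Nonempty :=
    ⟨(s₁ - 1, EuclideanSpace.single (1 : Fin 3) (1 : ℝ)), mk_mem_prod (by show s₁ - 1 < s₁; linarith) (by simp)⟩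
  have hOsub : O ⊆ Iio (0 : ℝ) ×ˢ univ :=
    prod_mono (fun s (hs : s < s₁) => show s < 0 from lt_of_lt_of_le hs hs₁) (subset_univ _)
  have hzero : ∀ p ∈ O, inner ℝ (curl (v p.1) p.2) HalfSpaceWindowDoorCirculationCarryingRigidityDefs.e3 = 0 := by
    rintro ⟨s, y⟩ ⟨hs, hy⟩
    have hs' : s < s₁ := hs
    have hs0 : s < 0 := lt_of_lt_of_le hs' hs₁
    have hy' : 0 < y 1 := hy
    have hv1 : ContDiff ℝ 1 (v s) := (hsm.contDiff_slice hs0).of_le (by norm_cast)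
    obtain ⟨r, θ, hr, -, hθ, hyeq⟩ := exists_cylPt_eq hy'
    have hωc : Continuous fun θ' => inner ℝ (curl (v s) (cylPt r θ' (y 2))) e3 * r :=
      (((continuous_curl hv1).comp (continuous_cylPt_θ r (y 2))).inner continuous_const).mul continuous_const
    have hnn : ∀ θ', 0 ≤ inner ℝ (curl (v s) (cylPt r θ' (y 2))) e3 * r :=
      fun θ' => mul_nonneg (hsign s hs0 _) hr.le
    have hint : ∫ θ' in (0 : ℝ)..(2 * Real.pi), inner ℝ (curl (v s) (cylPt r θ' (y 2))) e3 * r = 0 :=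
      hvort0 s hs' r hr (y 2)
    have h := eq_zero_of_integral_eq_zero_of_nonneg hωc hnn hint hθ
    rw [hyeq] at h
    show inner ℝ (curl (v s) y) e3 = 0
    exact (mul_eq_zero.1 h).resolve_right hr.ne'
  exact inner_curl_e3_eq_zero_of_open hrate hcont hmild hOopen hOne hOsub hzero

/-- **FAR-PAST MASTER CENSUS THEOREM OF THE TIME-ONLY CLASS.**  A door-class profile (`‖v(·,t)‖ ≤ C/√(−t)`) with the sign
`ω₃ ≥ 0` whose eddy torque obeys `ℛ ≤ (1 + r v̄_r)Γ/r² + κΓ/(−s)` on every axis circle at every time before some epoch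
`s₁ ≤ 0`, for some `0 ≤ κ < 1/2`, is POLOIDAL on the whole slab: `ω₃ ≡ 0`. -/
theorem inner_curl_e3_eq_zero_of_excess_lt_half_farPast (C κ s₁ : ℝ)
    (v : ℝ → EuclideanSpace ℝ (Fin 3) → EuclideanSpace ℝ (Fin 3))
    (hrate : HasTypeITimeDecay C v)
    (hcont : ContinuousOn (uncurry v) (Iio (0 : ℝ) ×ˢ univ))
    (hmild : ∀ s t : ℝ, s < t → t < 0 → ∀ x,
      v t x = UnboundedOperators.heatExtension (v s) (t - s) x - oseenDuhamel 1 s v v t x)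
    (hdiv : ∀ t < 0, VectorCalculus.IsDivFree (v t))
    (hs₁ : s₁ ≤ 0) (hκ0 : 0 ≤ κ) (hκ : κ < 1 / 2)
    (hsign : ∀ s < 0, ∀ y, 0 ≤ inner ℝ (curl (v s) y) (EuclideanSpace.single (2 : Fin 3) (1 : ℝ)))
    (hexc : ∀ s < s₁, ∀ r : ℝ, 0 < r → ∀ z : ℝ,
      remainder v r z s ≤ (1 + r * meanR v r z s) * circ v r z s / r ^ 2 + κ * circ v r z s / (-s)) :
    ∀ s < 0, ∀ y, inner ℝ (curl (v s) y) (EuclideanSpace.single (2 : Fin 3) (1 : ℝ)) = 0 := by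
  have hsm : IsSmoothSpaceTimeOn (Iio (0 : ℝ)) v := isSmoothSpaceTimeOn_of_class hrate hcont hmild hdiv
  have hsign' : SignE3 v := hsign
  have hF0 : ∀ t < s₁, ∀ x : EuclideanSpace ℝ (Fin 3), (2 * Real.pi)⁻¹ * circ v (cylRadius x) (x 2) t = 0 := by
    intro t ht x
    have ht0 : t < 0 := lt_of_lt_of_le ht hs₁
    by_cases hx : cylRadius x = 0
    · exact circF_axis v t hx
    have hV := V_nonpos_of_excess_ray hs₁ hrate hcont hmild hdiv hsign' hκ0 hκ hexc ht x
    have hV0 := V_nonneg hsm hsign' ht0 x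
    rcases div_eq_zero_iff.1 (le_antisymm hV hV0) with h | h
    · exact h
    · exact absurd h hx
  exact poloidal_of_circF_eq_zero_farPast hrate hcont hmild hdiv hsign' hs₁ hF0

end Summit.NavierStokesRegularity.NavierStokesRegularity.Theorems.HalfSpaceWindowDoorCirculationCarryingRigidityTimeOnlyExcessRay
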